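import Mathlib
import HarnessLib
import Summits.HubbardSuperconductivity.HubbardSuperconductivity.Theorems.KLProgrammeKLRegimeEngineV8DefsShiftU
import Summits.HubbardSuperconductivity.HubbardSuperconductivity.Theorems.KLProgrammeKLRegimeEngineV8DefsU4

/-!
# K3 ENGINE package: the (c) frame-shift door's RESPONSE NUMERAL `klHshiftC` — located item «(c)-HSHIFT-4LEG» (plan g24 (R273)(B): «the ONE input owed to
# the render is the NAME of the response numeral — `klHshiftC` as a def»); cell gate-hubbard-kl, seat gate-hubbard-kl-p2 g23 (producer of the numeral)

WHAT.  The consumer half (k3c2-p2 g21, `…EnginePairTransferOutClassFrameShift`: `hshift_of_frameResponse(_hist)`) turns a frame-Lipschitz response of the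
scale pair amplitude, `‖𝒞[K₁] − 𝒞[K₀]‖ ≤ ℓ·frameDist K₁ K₀` with `ℓ ≤ cℓ·(Klam U)²/Λ`, into the `hshift` binder `≤ frameShiftBar`, under the U-door
`512·cℓ·Gfr₀·|U| ≤ Q.CR`, i.e. `U ≤ klShiftU cℓ` (p1b g16, `…EngineV8DefsShiftU`).  The analytic door behind `ℓ` is this seat's
`covResp_norm_kernel_four_frameShift_sub_le'` (`…EngineFrameShiftResponseFourLeg`: `‖Δ𝒲₄(X)‖ ≤ (A₆·N₆ + A₄·S·N₄)·frameDist K₁ K₀`,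
`A₆ = 30·2L²(2B₁+1)βL²(2β/Λ)`, `A₄ = 32(2B₁+1)βL²/Λ²`; in `vertexFn` currency `A₆·N₆ ↦ 4(2B₁+1)·N₆^V/Λ` and `A₄·S·N₄ ↦ 16(2B₁+1)·S^V·N₄^V/Λ²`, `B₁ = 2736`
by `abs_deriv_salmhoferCutoff_le_numeral`).  The PRICING of `N₆, S, N₄` along the interpolation in the engine's currency (E-lineage / this lineage, later) fixes
the actual numeral; its pencil size is `(2B₁+1)·O(10²) ≈ 10⁶ < 2²⁰`.

THE NUMERAL.  **`klHshiftC := 2⁹⁶`** — a response numeral WITH ROOM (`2⁷⁶` over the pencil size): the producer's target `ℓ ≤ klHshiftC·(Klam U)²/Λ` is the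
weakest that costs the consumer NOTHING, because the U-door it induces is NEVER BINDING: `klShiftU klHshiftC = 1/(2¹⁰⁰ + 1) ≥ klEngU₀4 P R c = 2⁻¹²⁸/(Psq⁴Rsq⁴(c²+1))`
(`klEngU₀4_le_klShiftU_klHshiftC`), and every U-table of the lineage sits below `klEngU₀4` (`klEngU₀9 ≤ … ≤ klEngU₀4` by the `_le_` chain).  So the registrant may host
`⊓ klShiftU klHshiftC` as ruled ((R273)(B)) or read the door from the existing `klEngU₀4` row — both are served here:
* `klHshiftC`, `klHshiftC_eq`, `klHshiftC_pos`, `klHshiftC_nonneg`; `klShiftU_klHshiftC` (`= 1/(2¹⁰⁰+1)`);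
* **`klEngU₀4_le_klShiftU_klHshiftC`** (never binding); **`hshift_door_klHshiftC_of_le_klEngU₀4`**: `R.WF → (klEngQ8 P R).IsRaiseOf Q → 0 < U → U ≤ klEngU₀4 P R c →
  512·klHshiftC·R.Gfr 0·|U| ≤ Q.CR` (p1b's `hshift_door_of_le_klShiftU_raise` below `klEngU₀4`).
A definition with a literal body + order lemmas; nothing about the model is asserted; the located risk #6 («(c)-HSHIFT-4LEG»: the response ROW with this numeral)
stays OPEN until priced; nothing here asserts (c), any stub of 20437, K3 or superconductivity.
-/

noncomputable section

namespace Summit.HubbardSuperconductivity.HubbardSuperconductivity.Theorems.EngineV8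

set_option linter.dupNamespace false -- summit = problem name (single-conjunct summit), D-0017

open Real Summit.HubbardSuperconductivity.HubbardSuperconductivity.Theorems.KLRegimeSplit

/-- **`klHshiftC := 2⁹⁶`** — the frame-shift door's response numeral (located «(c)-HSHIFT-4LEG»), with room `2⁷⁶` over the pencil size of the four-leg
door's constants; the induced U-door `klShiftU klHshiftC = 1/(2¹⁰⁰+1)` is never binding (`≥ klEngU₀4`). -/
def klHshiftC : ℝ := 2 ^ 96

/-- `klHshiftC = 2⁹⁶`. -/
theorem klHshiftC_eq : klHshiftC = 2 ^ 96 := rfl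

/-- `0 < klHshiftC`. -/
theorem klHshiftC_pos : 0 < klHshiftC := by unfold klHshiftC; positivity

/-- `0 ≤ klHshiftC`. -/
theorem klHshiftC_nonneg : 0 ≤ klHshiftC := klHshiftC_pos.le

/-- **The induced U-door in closed form**: `klShiftU klHshiftC = 1/(2¹⁰⁰ + 1)` (`16·2⁹⁶ = 2¹⁰⁰`). -/
theorem klShiftU_klHshiftC : klShiftU klHshiftC = 1 / (2 ^ 100 + 1) := by
  unfold klShiftU klHshiftC
  rw [max_eq_left (by positivity)]
  norm_num

/-- **NEVER BINDING**: `klEngU₀4 P R c ≤ klShiftU klHshiftC` (`2¹⁰⁰ + 1 ≤ 2¹²⁸ ≤ 2¹²⁸·Psq⁴·Rsq⁴·(c²+1)`). -/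
theorem klEngU₀4_le_klShiftU_klHshiftC (P : SplitConsts) (R : RenConsts) (c : ℝ) : klEngU₀4 P R c ≤ klShiftU klHshiftC := by
  rw [klShiftU_klHshiftC]
  unfold klEngU₀4
  have hp : 1 ≤ klEngPsq P := one_le_klEngPsq P
  have hr : 1 ≤ klEngRsq R := one_le_klEngRsq R
  refine one_div_le_one_div_of_le (by positivity) ?_
  have h4p : 1 ≤ klEngPsq P ^ 4 := one_le_pow₀ hp
  have h4r : 1 ≤ klEngRsq R ^ 4 := one_le_pow₀ hr
  have hc : 1 ≤ c ^ 2 + 1 := by nlinarith [sq_nonneg c]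
  calc (2 : ℝ) ^ 100 + 1 ≤ 2 ^ 128 * 1 * 1 * 1 := by norm_num
    _ ≤ 2 ^ 128 * klEngPsq P ^ 4 * klEngRsq R ^ 4 * (c ^ 2 + 1) := by gcongr

/-- **The U-door of `hshift_of_frameResponse` at the numeral `klHshiftC`, below `klEngU₀4`** (hence below every U-table of the lineage), at any raise `Q` of
`klEngQ8 P R`: `512·klHshiftC·R.Gfr 0·|U| ≤ Q.CR`. -/
theorem hshift_door_klHshiftC_of_le_klEngU₀4 {P : SplitConsts} {R : RenConsts} {Q : EngConsts} {U c : ℝ} (hR : R.WF) (hQ : (klEngQ8 P R).IsRaiseOf Q)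
    (hU : 0 < U) (hUle : U ≤ klEngU₀4 P R c) : 512 * klHshiftC * R.Gfr 0 * |U| ≤ Q.CR :=
  hshift_door_of_le_klShiftU_raise klHshiftC_nonneg hR hQ hU (hUle.trans (klEngU₀4_le_klShiftU_klHshiftC P R c))

end Summit.HubbardSuperconductivity.HubbardSuperconductivity.Theorems.EngineV8

end
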